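import Summits.AnomalousDissipation.AnomalousDissipation.Theses.MomentParity

/-!
# `MomentParity.LadderGlue2` (stmt-AnomalousDissipation-14332): proof

`Summit.AnomalousDissipation.AnomalousDissipation.Theses.MomentParity.LadderGlue2` —
the glue of the cruxes into the target of route MomentParity:
`QuarticGate → QuarticTightness → UniformResolution → MomentLadder`.

Pure logic: unpack the force `f`, the viscosities `ν` and the budgets `E, ε` from `QuarticGate`;
`QuarticTightness` (order-4 tightness along `ν_j → 0`) turns its per-`j` body into the
`MomentLadder` body minus the resolution clause with new budgets `E₁, ε₁`; `UniformResolution`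
adds the `N`-uniform resolution schedule `κ` with budgets `E₂, ε₂`; repack as `MomentLadder`.
-/

-- `Summit.<Summit>.<Problem>` is the tree's mandated summit-side namespace (CONVENTIONS §2); for this
-- single-conjunct summit the two coincide, so the duplicate is deliberate.
set_option linter.dupNamespace false

namespace Summit.AnomalousDissipation.AnomalousDissipation.Theorems

open Summit.AnomalousDissipation.AnomalousDissipation.Theses.MomentParity

/-- **Glue of the cruxes of route MomentParity into its target** (stmt-AnomalousDissipation-14332):
`QuarticGate → QuarticTightness → UniformResolution → MomentLadder`, by pure logic — the force,
viscosity sequence and positivity of `ν j` come from `QuarticGate`, the budgets are replaced twice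
(`QuarticTightness`, then `UniformResolution`), and the final per-`j` body is `MomentLadder`'s
verbatim. -/
theorem ladderGlue2_proof : LadderGlue2 := by
  unfold LadderGlue2
  intro hQ hT hU
  obtain ⟨f, hfs, hfd, hfz, ν, E, ε, hν, hν0, hε, hj⟩ := hQ
  obtain ⟨E₁, ε₁, hε₁, h₁⟩ := hT f hfs hfd hfz ν E ε hν hν0 hε hj
  obtain ⟨E₂, ε₂, hε₂, h₂⟩ := hU f hfs hfd hfz ν E₁ ε₁ hν hν0 hε₁ h₁
  exact ⟨f, hfs, hfd, hfz, ν, E₂, ε₂, hν, hν0, hε₂, h₂⟩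

end Summit.AnomalousDissipation.AnomalousDissipation.Theorems
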